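import Summits.CriticalPhenomena.PercolationContinuityZ3.Theorems.PercNearOneGluingNoHeavyQuantFarTreeChainStep
import HarnessLib

/-!
# QUANT lane R8 — the SPINE IDENTITY at every layer: `P(N ≥ i)` as the chain-indexed average of level probabilities

builds on p205010 (kernel theorem, internal audit signed; external expert review pending)

Support file (`--supports stmt-CriticalPhenomena-4575`), QUANT lane typer seat prim-quant-stmt (gen 12), rung R8 of
`run/shared/lean/prim/quant/LADDER.md`.  The census's SPINE CERTIFICATE programme for FAR on trees (`Quant.FarTreeRow`;
prim-quant-census-1/GX-MULTIBLOCK-G8.md §6, README V117, LEAD-NOTES-G6 N14 (1a)) starts from the exact identity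
`P(N ≥ j+1) = Σ_{k<d} π_k (1 − p_{k+1}) · P(S_k ≥ j+1) + π_d · P(S_d ≥ j+1)` along the chain `v_0 … v_d` of the least likely
relay: conditionally on the chain being open exactly down to `v_k`, the relay count is the count `S_k` of the forests hanging at
`v_0 … v_k`, which is independent of the chain.  The lead's `Quant.chain_step_real_general` (…QuantFarTreeChainStepGeneral.lean) is
ONE step of it; this file proves the WHOLE identity directly, by partitioning on the open prefix of the chain, in generic gate
coordinates and for an arbitrary assignment of levels (no tree axiom needed):

* Data: gates `ι` (`prodBernoulli q` on `Set ι`), a chain `e 0, …, e (d−1)` of distinct gates, witnesses `b ∈ S` with a level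
  `ℓ b ≤ d` and an inner gate set `J b` avoiding the chain, the witness's full gate set being `I b = {e l | l < ℓ b} ∪ J b`
  (so `b` is reached iff the chain is open down to level `ℓ b` and `J b` is open).  Inner sets of different witnesses may overlap
  (several relays in one hanging subtree).
* `Quant.chain_prefix_cases` — every configuration opens the chain exactly down to some level `k < d` (gate `e k` closed) or opens all of it.
* `Quant.spine_identity` — for every threshold `i`:
  `P(#{b ∈ S | I b open} ≥ i) = Σ_{k<d} (∏_{l<k} q (e l)) (1 − q (e k)) · P(#{b ∈ S | ℓ b ≤ k, J b open} ≥ i)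
                               + (∏_{l<d} q (e l)) · P(#{b ∈ S | J b open} ≥ i)`.
  The level events are written as `((S.filter (ℓ · ≤ k)).filter (J · open)).card`, i.e. in the witness/gate-set vocabulary of the
  per-level bounds of …QuantFarTreeLevelBounds.lean (Harris witness, union bound over closed cuts, Cantelli), which can therefore be
  applied to each level term verbatim.

Theorems only; no sorries; standard axioms.  [this work]; independence of disjointly supported events [cite: Grimmett1999, §2.2].
-/

noncomputable section

namespace Summit.CriticalPhenomena.PercolationContinuityZ3.Theorems

namespace Quant

open Finset MeasureTheory
open Literature.Probability.LatticeModels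
open Literature.Probability.Percolation
open scoped Classical

variable {ι κ : Type*}

/-! ### Chain bookkeeping -/

/-- Every configuration opens the chain `e 0, e 1, …` exactly down to some level `k < d` (gates `e l`, `l < k`, open and `e k`
closed) or opens all `d` chain gates. [folklore] -/
theorem chain_prefix_cases (e : ℕ → ι) (d : ℕ) (ω : Set ι) :
    (∃ k < d, (∀ l < k, e l ∈ ω) ∧ e k ∉ ω) ∨ (∀ l < d, e l ∈ ω) := by
  induction d with
  | zero => exact Or.inr fun l hl => absurd hl (Nat.not_lt_zero l)
  | succ d ih =>
    rcases ih with ⟨k, hk, h1, h2⟩ | h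
    · exact Or.inl ⟨k, by omega, h1, h2⟩
    · by_cases hd : e d ∈ ω
      · refine Or.inr fun l hl => ?_
        rcases Nat.lt_succ_iff_lt_or_eq.1 hl with hl' | rfl
        · exact h l hl'
        · exact hd
      · exact Or.inl ⟨d, Nat.lt_succ_self d, h, hd⟩

/-- The image of a chain prefix is open iff each of its gates is. [folklore] -/
theorem coe_image_range_subset_iff (e : ℕ → ι) (n : ℕ) (ω : Set ι) :
    (((Finset.range n).image e : Finset ι) : Set ι) ⊆ ω ↔ ∀ l < n, e l ∈ ω := by
  constructor
  · intro h l hl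
    exact h (Finset.mem_coe.2 (Finset.mem_image.2 ⟨l, Finset.mem_range.2 hl, rfl⟩))
  · intro h x hx
    obtain ⟨l, hl, rfl⟩ := Finset.mem_image.1 (Finset.mem_coe.1 hx)
    exact h l (Finset.mem_range.1 hl)

/-- An event read off the chain gates `e l`, `l < d`, is determined by them. [folklore] -/
theorem determinedBy_chain (e : ℕ → ι) (d : ℕ) (Φ : (ℕ → Prop) → Prop) :
    DeterminedBy {ω : Set ι | Φ fun l => l < d → e l ∈ ω} (↑((Finset.range d).image e) : Set ι) := by
  rw [determinedBy_iff]
  intro ω ω' h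
  have key : (fun l => l < d → e l ∈ ω) = fun l => l < d → e l ∈ ω' := by
    funext l
    refine propext ⟨fun hω hl => ?_, fun hω hl => ?_⟩
    · have : e l ∈ ω ∩ ↑((Finset.range d).image e) :=
        ⟨hω hl, Finset.mem_coe.2 (Finset.mem_image.2 ⟨l, Finset.mem_range.2 hl, rfl⟩)⟩
      rw [h] at this
      exact this.1
    · have : e l ∈ ω' ∩ ↑((Finset.range d).image e) :=
        ⟨hω hl, Finset.mem_coe.2 (Finset.mem_image.2 ⟨l, Finset.mem_range.2 hl, rfl⟩)⟩
      rw [← h] at this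
      exact this.1
  simp only [Set.mem_setOf_eq, key]

/-! ### The spine identity -/

variable [Finite ι]

/-- Probability that the chain is open exactly down to level `k < d`: `(∏_{l<k} q (e l)) (1 − q (e k))`. [folklore] -/
theorem prodBernoulli_real_chain_prefix (q : ι → unitInterval) (d : ℕ) (e : ℕ → ι)
    (he : ∀ l < d, ∀ l' < d, e l = e l' → l = l') (k : ℕ) (hk : k < d) :
    (prodBernoulli q).real {ω : Set ι | (∀ l < k, e l ∈ ω) ∧ e k ∉ ω} =
      (∏ l ∈ Finset.range k, (q (e l) : ℝ)) * (1 - (q (e k) : ℝ)) := by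
  have hmeas : ∀ T : Set (Set ι), MeasurableSet T := fun T => (Set.toFinite T).measurableSet
  have hset : {ω : Set ι | (∀ l < k, e l ∈ ω) ∧ e k ∉ ω} =
      {ω : Set ι | (((Finset.range k).image e : Finset ι) : Set ι) ⊆ ω} ∩ {ω : Set ι | e k ∉ ω} := by
    ext ω
    simp only [Set.mem_setOf_eq, Set.mem_inter_iff, coe_image_range_subset_iff]
  have hdisj : Disjoint ((Finset.range k).image e) ({e k} : Finset ι) := by
    rw [Finset.disjoint_singleton_right, Finset.mem_image]
    rintro ⟨l, hl, hle⟩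
    have := he l (by have := Finset.mem_range.1 hl; omega) k hk hle
    have := Finset.mem_range.1 hl
    omega
  have dA : DeterminedBy {ω : Set ι | (((Finset.range k).image e : Finset ι) : Set ι) ⊆ ω}
      (↑((Finset.range k).image e) : Set ι) := determinedBy_subset_open _
  have dB : DeterminedBy {ω : Set ι | e k ∉ ω} (↑({e k} : Finset ι) : Set ι) := by
    rw [determinedBy_iff]
    intro ω ω' h
    simp only [Set.mem_setOf_eq]
    have h1 : e k ∈ ω ↔ e k ∈ ω' := by
      constructor
      · intro hω
        have : e k ∈ ω ∩ ↑({e k} : Finset ι) := ⟨hω, by simp⟩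
        rw [h] at this; exact this.1
      · intro hω
        have : e k ∈ ω' ∩ ↑({e k} : Finset ι) := ⟨hω, by simp⟩
        rw [← h] at this; exact this.1
    exact not_congr h1
  rw [hset, prodBernoulli_real_inter_of_determinedBy_disjoint q hdisj dA dB (hmeas _) (hmeas _),
    prodBernoulli_real_subset, prodBernoulli_real_setOf_notMem]
  congr 1
  refine Finset.prod_image fun l hl l' hl' hll' => he l ?_ l' ?_ hll'
  · have := Finset.mem_range.1 hl; omega
  · have := Finset.mem_range.1 hl'; omega

omit [Finite ι] in
/-- Probability that the whole chain is open: `∏_{l<d} q (e l)`. [folklore] -/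
theorem prodBernoulli_real_chain_all (q : ι → unitInterval) (d : ℕ) (e : ℕ → ι)
    (he : ∀ l < d, ∀ l' < d, e l = e l' → l = l') :
    (prodBernoulli q).real {ω : Set ι | ∀ l < d, e l ∈ ω} = ∏ l ∈ Finset.range d, (q (e l) : ℝ) := by
  have hset : {ω : Set ι | ∀ l < d, e l ∈ ω} = {ω : Set ι | (((Finset.range d).image e : Finset ι) : Set ι) ⊆ ω} := by
    ext ω
    simp only [Set.mem_setOf_eq, coe_image_range_subset_iff]
  rw [hset, prodBernoulli_real_subset]
  refine Finset.prod_image fun l hl l' hl' hll' => he l ?_ l' ?_ hll'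
  · exact Finset.mem_range.1 hl
  · exact Finset.mem_range.1 hl'

/-- **The spine identity (every layer, generic levels).**  Chain gates `e 0, …, e (d−1)` (distinct); witnesses `b ∈ S` with levels
`ℓ b ≤ d`, inner gate sets `J b` avoiding the chain, full gate sets `I b = {e l | l < ℓ b} ∪ J b`.  For every threshold `i`:
`P(#{b ∈ S | I b open} ≥ i) = Σ_{k<d} (∏_{l<k} q (e l))(1 − q (e k))·P(#{b ∈ S | ℓ b ≤ k, J b open} ≥ i) + (∏_{l<d} q (e l))·P(#{b ∈ S | J b open} ≥ i)`.
[this work] -/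
theorem spine_identity (q : ι → unitInterval) (d : ℕ) (e : ℕ → ι)
    (he : ∀ l < d, ∀ l' < d, e l = e l' → l = l')
    (S : Finset κ) (I J : κ → Finset ι) (ℓ : κ → ℕ) (hℓ : ∀ b ∈ S, ℓ b ≤ d)
    (hI : ∀ b ∈ S, I b = (Finset.range (ℓ b)).image e ∪ J b)
    (hJ : ∀ b ∈ S, ∀ l < d, e l ∉ J b) (i : ℕ) :
    (prodBernoulli q).real {ω : Set ι | i ≤ (S.filter fun b => ((I b : Finset ι) : Set ι) ⊆ ω).card} =
      ∑ k ∈ Finset.range d, (∏ l ∈ Finset.range k, (q (e l) : ℝ)) * (1 - (q (e k) : ℝ)) *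
          (prodBernoulli q).real
            {ω : Set ι | i ≤ ((S.filter fun b => ℓ b ≤ k).filter fun b => ((J b : Finset ι) : Set ι) ⊆ ω).card} +
        (∏ l ∈ Finset.range d, (q (e l) : ℝ)) *
          (prodBernoulli q).real {ω : Set ι | i ≤ (S.filter fun b => ((J b : Finset ι) : Set ι) ⊆ ω).card} := by
  set μ := prodBernoulli q with hμ
  have hmeas : ∀ T : Set (Set ι), MeasurableSet T := fun T => (Set.toFinite T).measurableSet
  -- the pieces of the partition and the level events
  set E : ℕ → Set (Set ι) := fun k => {ω : Set ι | (∀ l < k, e l ∈ ω) ∧ e k ∉ ω} with hE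
  set Ed : Set (Set ι) := {ω : Set ι | ∀ l < d, e l ∈ ω} with hEd
  set C : ℕ → Set (Set ι) := fun k =>
    {ω : Set ι | i ≤ ((S.filter fun b => ℓ b ≤ k).filter fun b => ((J b : Finset ι) : Set ι) ⊆ ω).card} with hC
  set Cd : Set (Set ι) := {ω : Set ι | i ≤ (S.filter fun b => ((J b : Finset ι) : Set ι) ⊆ ω).card} with hCd
  -- reading a witness
  have hreach : ∀ b ∈ S, ∀ ω : Set ι,
      ((I b : Finset ι) : Set ι) ⊆ ω ↔ (∀ l < ℓ b, e l ∈ ω) ∧ ((J b : Finset ι) : Set ι) ⊆ ω := by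
    intro b hb ω
    rw [hI b hb, Finset.coe_union, Set.union_subset_iff, coe_image_range_subset_iff]
  -- the count on each piece
  have count_E : ∀ k < d, ∀ ω ∈ E k, (S.filter fun b => ((I b : Finset ι) : Set ι) ⊆ ω) =
      (S.filter fun b => ℓ b ≤ k).filter fun b => ((J b : Finset ι) : Set ι) ⊆ ω := by
    intro k hk ω hω
    rw [Finset.filter_filter]
    refine Finset.filter_congr fun b hb => ?_
    rw [hreach b hb ω]
    refine and_congr_left fun _ => ⟨fun h => ?_, fun h l hl => hω.1 l (lt_of_lt_of_le hl h)⟩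
    by_contra hlt
    exact hω.2 (h k (by omega))
  have count_Ed : ∀ ω ∈ Ed, (S.filter fun b => ((I b : Finset ι) : Set ι) ⊆ ω) =
      S.filter fun b => ((J b : Finset ι) : Set ι) ⊆ ω := by
    intro ω hω
    refine Finset.filter_congr fun b hb => ?_
    rw [hreach b hb ω]
    exact ⟨fun h => h.2, fun h => ⟨fun l hl => hω l (lt_of_lt_of_le hl (hℓ b hb)), h⟩⟩
  -- the event identity
  have hev : {ω : Set ι | i ≤ (S.filter fun b => ((I b : Finset ι) : Set ι) ⊆ ω).card} =
      (⋃ k ∈ Finset.range d, (E k ∩ C k)) ∪ (Ed ∩ Cd) := by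
    ext ω
    simp only [Set.mem_setOf_eq, Set.mem_union, Set.mem_iUnion, Set.mem_inter_iff, Finset.mem_range, exists_prop]
    constructor
    · intro hcount
      rcases chain_prefix_cases e d ω with ⟨k, hk, h1, h2⟩ | h
      · refine Or.inl ⟨k, hk, ⟨h1, h2⟩, ?_⟩
        show i ≤ ((S.filter fun b => ℓ b ≤ k).filter fun b => ((J b : Finset ι) : Set ι) ⊆ ω).card
        rw [← count_E k hk ω ⟨h1, h2⟩]; exact hcount
      · refine Or.inr ⟨h, ?_⟩
        show i ≤ (S.filter fun b => ((J b : Finset ι) : Set ι) ⊆ ω).card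
        rw [← count_Ed ω h]; exact hcount
    · rintro (⟨k, hk, hEk, hCk⟩ | ⟨hEdω, hCdω⟩)
      · have h' : i ≤ ((S.filter fun b => ℓ b ≤ k).filter fun b => ((J b : Finset ι) : Set ι) ⊆ ω).card := hCk
        rw [count_E k hk ω hEk]; exact h'
      · have h' : i ≤ (S.filter fun b => ((J b : Finset ι) : Set ι) ⊆ ω).card := hCdω
        rw [count_Ed ω hEdω]; exact h'
  -- disjointness
  have hdj_fam : (↑(Finset.range d) : Set ℕ).PairwiseDisjoint fun k => E k ∩ C k := by
    intro k hk k' hk' hkk'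
    rw [Function.onFun, Set.disjoint_left]
    intro ω h h'
    have a : ω ∈ E k := h.1
    have b : ω ∈ E k' := h'.1
    rcases lt_or_gt_of_ne hkk' with hlt | hlt
    · exact a.2 (b.1 k hlt)
    · exact b.2 (a.1 k' hlt)
  have hdj1 : Disjoint (⋃ k ∈ Finset.range d, (E k ∩ C k)) (Ed ∩ Cd) := by
    rw [Set.disjoint_left]
    intro ω h h'
    obtain ⟨k, hk, hk'⟩ := Set.mem_iUnion₂.1 h
    have a : ω ∈ E k := hk'.1
    exact a.2 (h'.1 k (Finset.mem_range.1 hk))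
  -- independence on each piece
  set Kd : Finset ι := (Finset.range d).image e with hKd
  set F : Finset ι := S.biUnion J with hF
  have hKF : Disjoint Kd F := by
    rw [Finset.disjoint_left]
    intro x hx hxF
    obtain ⟨l, hl, rfl⟩ := Finset.mem_image.1 hx
    obtain ⟨b, hb, hbx⟩ := Finset.mem_biUnion.1 hxF
    exact hJ b hb l (Finset.mem_range.1 hl) hbx
  have dE : ∀ k < d, DeterminedBy (E k) (↑Kd : Set ι) := by
    intro k hk
    have hset : E k = {ω : Set ι | (fun P : ℕ → Prop => (∀ l < k, P l) ∧ ¬ P k) fun l => l < d → e l ∈ ω} := by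
      ext ω
      simp only [hE, Set.mem_setOf_eq]
      constructor
      · rintro ⟨h1, h2⟩
        exact ⟨fun l hl _ => h1 l hl, fun h => h2 (h hk)⟩
      · rintro ⟨h1, h2⟩
        exact ⟨fun l hl => h1 l hl (by omega), fun h => h2 fun _ => h⟩
    rw [hset, hKd]
    exact determinedBy_chain e d (fun P : ℕ → Prop => (∀ l < k, P l) ∧ ¬ P k)
  have dEd : DeterminedBy Ed (↑Kd : Set ι) := by
    have hset : Ed = {ω : Set ι | (fun P : ℕ → Prop => ∀ l, P l) fun l => l < d → e l ∈ ω} := by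
      ext ω
      simp only [hEd, Set.mem_setOf_eq]
    rw [hset, hKd]
    exact determinedBy_chain e d (fun P : ℕ → Prop => ∀ l, P l)
  have dC : ∀ k, DeterminedBy (C k) (↑F : Set ι) := by
    intro k
    refine determinedBy_card_filter_open (S.filter fun b => ℓ b ≤ k) J F (fun b hb => ?_) (fun n => i ≤ n)
    exact Finset.subset_biUnion_of_mem J (Finset.mem_filter.1 hb).1
  have dCd : DeterminedBy Cd (↑F : Set ι) :=
    determinedBy_card_filter_open S J F (fun b hb => Finset.subset_biUnion_of_mem J hb) (fun n => i ≤ n)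
  have pk : ∀ k < d, μ.real (E k ∩ C k) =
      (∏ l ∈ Finset.range k, (q (e l) : ℝ)) * (1 - (q (e k) : ℝ)) * μ.real (C k) := by
    intro k hk
    rw [prodBernoulli_real_inter_of_determinedBy_disjoint q hKF (dE k hk) (dC k) (hmeas _) (hmeas _),
      prodBernoulli_real_chain_prefix q d e he k hk]
  have pd : μ.real (Ed ∩ Cd) = (∏ l ∈ Finset.range d, (q (e l) : ℝ)) * μ.real Cd := by
    rw [prodBernoulli_real_inter_of_determinedBy_disjoint q hKF dEd dCd (hmeas _) (hmeas _),
      prodBernoulli_real_chain_all q d e he]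
  -- assemble
  rw [hev, measureReal_union hdj1 (hmeas _) (measure_ne_top _ _) (measure_ne_top _ _),
    measureReal_biUnion_finset hdj_fam (fun k _ => hmeas _) (fun k _ => measure_ne_top _ _), pd]
  congr 1
  exact Finset.sum_congr rfl fun k hk => pk k (Finset.mem_range.1 hk)

end Quant

end Summit.CriticalPhenomena.PercolationContinuityZ3.Theorems
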